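import Summits.BirchSwinnertonDyer.Rank1Residual.F1Sign2.HeegnerCuspSymbolAtTwo
import Summits.BirchSwinnertonDyer.BirchSwinnertonDyer.Theorems.ByReductionTypeAtTwoRankOneAtTwoBigImageOddLocalOneDoorEggKappaDictionary
import Summits.BirchSwinnertonDyer.BirchSwinnertonDyer.Theorems.ByReductionTypeAtTwoRankOneAtTwoBigImageOddLocalOneDoorMinusPeriodUnitHalf
import HarnessLib

/-!
# Cell `bsd-f1-sign2`, lens `-an` g17 — AN-34 Heegner cusp symbol, SIBLING of `F1Sign2/HeegnerCuspSymbolAtTwo.lean` (p671131, 391 l., at the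
# 400-line cap for proof-carrying `F1Sign2` files): the `Sketch_v48` deltas, starting with AN-34g′ under the planner's NAME, kernel-linked to the
# typer's REF1-repaired AN-34g

PORT (cell `bsd-f1-sign2`, seat `-ty` g13, D-an-90 continued) from -an g17's `HOME/MEMO-an-data/g17/Sketch_v48.lean` ccd90c20e9849e27 (= MEMO-an v1.54
FILE OF RECORD after REF1 §143, INBOX 2026-08-28T21:45:25Z).  -an folded REF1 §143 simultaneously with the typer's port p671131 (v46 packet + REF1's
two repairs under -an's v46 names): v48 RENAMES the repaired AN-34g to AN-34g′ `AxisMinusPeriodUnitLatticeBookkeepingAtTwo` (binders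
`a d + N b² = 1 → b ≠ 0 →`, without the now-redundant `IsCoprime a (N b)` the typer kept from v46).  This file carries AN-34g′ VERBATIM and PROVES it
equivalent to the tree's `ANg17.MinusPeriodUnitLatticeBookkeepingAtTwo` (`a·d + b·(N b) = 1` IS the coprimality witness), so consumers may use either
name and CANDIDATES keeps ONE row (AN-34g′ = AN-34g-repaired; REF1 §143 (5) REPAIR C′; REF2 D-an-93: lattice bookkeeping, beyond-print no).
APPENDED in §20.6/§20.7 below (pass 3, after -an's v50 reconciliation and REF1 §143-add2) — the v48-era plan read: AN-34k `HeegnerCuspSymbolAxisIndependenceAtTwo`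
(v47, theorem-candidate), AN-34l `MinusUnitsOddRatioAtTwo` (typer pre-screen: refutable AS TYPED — `IsMinusSymbolUnit` is not maximal, so halving
`u′` keeps it a symbol unit and makes `u/u′` even; needs the maximal symbol unit or an `∃ u′` form), AN-34m `AxisDoorThreeCyclePrimeSupplyAtTwo`
(= REF1's C″ with the planner's binders), AN-34f with the extra binder `W.HasSurjectiveModNGaloisRep 2` (the tree's `EtaOneHasBottomRungDoorAtTwo`
is the REF1-audited v46 form WITHOUT it), and the rebuilt shape-only glue `EtaOneReductionAtTwo`.
Nothing here proves BSD; 23715 not closed; no `sorry`, no `@[conjecture]`, no instance, no notation; new named Literature facts: 0.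
PARTITION: none moved; beyond-print theorem: no; bears_on: stmt-BirchSwinnertonDyer-23715.
-/

set_option autoImplicit false

noncomputable section

open scoped Classical MatrixGroups ModularForm

open CongruenceSubgroup Literature.NumberTheory.EllipticCurves Literature.NumberTheory.EllipticCurves.ModularForms
  Summit.BirchSwinnertonDyer.Rank1Residual.F1Sign2

namespace Summit.BirchSwinnertonDyer.Rank1Residual.F1Sign2.ANg17

/-! ### §20.5 (v48) AN-34g′ under the planner's name + KERNEL equivalence with the typer's repaired AN-34g -/

/-- **AN-34g′ `AxisMinusPeriodUnitLatticeBookkeepingAtTwo` (THEOREM-CANDIDATE, bookkeeping between the two currencies ON AXIS CUSPS).**  For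
`Δ > 0`, `E(ℚ)[2] = 0` and an ODD constant `c`, at an AXIS cusp `r = −a/(Nb)` (`a d + N b² = 1`, so `{∞, r}_f ∈ iℝ` by AN-34a): the lattice bit of
AN-34b equals the parity of the minus cusp symbol in period units, `c·{∞, r}_f/2 ∉ Λ_E ↔ [r]⁻_f/u` odd.  v48 REPAIR of AN-34g
`MinusPeriodUnitLatticeBookkeepingAtTwo` (KILLED AS TYPED by REF1 §143: it quantified over ALL cusps `−a/(Nb)`; witness `37a1`, `r = −32/37`:
`{∞,r} = ω₁` real, `c{∞,r}/2 ∉ Λ` but `[r]⁻ = 0`; 176/176 violating cusps non-axis, 584/584 axis cusps satisfy the repaired form, REF1 kit `j318446`).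
[-ty g13 note: in the tree the name `ANg17.MinusPeriodUnitLatticeBookkeepingAtTwo` (`F1Sign2/HeegnerCuspSymbolAtTwo.lean` §20.4, p671131) already denotes
the REF1-REPAIRED form (axis completion + the redundant `IsCoprime a (N b)` binder of v46) — the killed v44–v46 body was never filed; the two tree
decls are equivalent: `axisMinusPeriodUnitLatticeBookkeepingAtTwo_iff` below.]
Proof sketch (REF1): `cΛ_f ⊆ Λ_W` has odd index, so `Λ_f ∩ iℝ = (k′/c)ℤω₂` with `k′` odd and `u ↔ (k′/c)ω₂`. [folklore] [cite: Cremona1997Algorithms, §2.8] -/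
def AxisMinusPeriodUnitLatticeBookkeepingAtTwo : Prop :=
  ∀ (W : WeierstrassCurve ℚ) [W.IsElliptic] [W.IsGloballyMinimal] [NeZero (W.conductorNorm ℤ)],
    0 < W.Δ → NoRationalTwoTorsion W →
    ∀ (Dt : ModularParametrizationData W (W.conductorNorm ℤ)), Odd Dt.c →
      ∀ (u : ℚ), IsMinusPeriodUnit Dt.f u →
      ∀ (a b d : ℤ), a * d + (W.conductorNorm ℤ : ℤ) * b ^ 2 = 1 → b ≠ 0 →
        ((Dt.c : ℂ) * modularSymbol Dt.f (axisCusp (W.conductorNorm ℤ) a b) / 2 ∉ Dt.L.lattice ↔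
          ∃ z : ℤ, Odd z ∧ ratMinusSymbol Dt.f (axisCusp (W.conductorNorm ℤ) a b) = z * u)

/-- KERNEL glue (-ty g13): the planner's v48 AN-34g′ and the typer's REF1-repaired AN-34g (`F1Sign2/HeegnerCuspSymbolAtTwo.lean` §20.4; the same
statement with the redundant coprimality binder) are EQUIVALENT — `a·d + b·(N·b) = a d + N b² = 1` is an `IsCoprime a (N b)` witness. -/
theorem axisMinusPeriodUnitLatticeBookkeepingAtTwo_iff :
    AxisMinusPeriodUnitLatticeBookkeepingAtTwo ↔ MinusPeriodUnitLatticeBookkeepingAtTwo := by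
  constructor
  · intro h W _ _ _ hΔ hT Dt hc u hu a b d hdet hb _
    exact h W hΔ hT Dt hc u hu a b d hdet hb
  · intro h W _ _ _ hΔ hT Dt hc u hu a b d hdet hb
    exact h W hΔ hT Dt hc u hu a b d hdet hb ⟨d, b, by linear_combination hdet⟩

/-- AN-34g′ ⇒ the tree's repaired AN-34g (one direction of `axisMinusPeriodUnitLatticeBookkeepingAtTwo_iff`, for consumers holding AN-34g′). -/
theorem minusPeriodUnitLatticeBookkeepingAtTwo_of_axis (h : AxisMinusPeriodUnitLatticeBookkeepingAtTwo) :
    MinusPeriodUnitLatticeBookkeepingAtTwo :=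
  axisMinusPeriodUnitLatticeBookkeepingAtTwo_iff.mp h

/-- The tree's repaired AN-34g ⇒ AN-34g′ (the other direction, for consumers holding the typer's name). -/
theorem axisMinusPeriodUnitLatticeBookkeepingAtTwo_of (h : MinusPeriodUnitLatticeBookkeepingAtTwo) :
    AxisMinusPeriodUnitLatticeBookkeepingAtTwo :=
  axisMinusPeriodUnitLatticeBookkeepingAtTwo_iff.mpr h

open UpperHalfPlane Summit.BirchSwinnertonDyer.Rank1Residual.F1Sign2.ANg16 Summit.BirchSwinnertonDyer.Rank1Residual.F1Sign2.TranspositionDoor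
  Summit.BirchSwinnertonDyer.BirchSwinnertonDyer.Theorems.RankOneAtTwoOneDoor

/-! ### §20.6 APPEND (-ty g13, pass 3; -an g17 `Sketch_v50.lean` 7a84a000673b68b8 = MEMO-an v1.57 FILE OF RECORD, INBOX 2026-08-28T22:24:32Z): the post-§143
deltas — AN-34k (axis independence), AN-34l′ (period unit `= 1/2`), AN-34m (= REF1 C″: axis ∧ admissible ∧ 3-cycle prime supply), the rebuilt shape-only
glue `EtaOneReductionAtTwo`, and AN-34n (the κ·m dictionary) — all plain `def`s (theorem-candidates / shape), bodies VERBATIM from v50; AN-34l′/AN-34l″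
(p676701) and AN-34n (p674563) are TREE THEOREMS of `bsd-line-fkl-p2` g14 — their `_holds` are one-line `exact`s below (pass 4, after the p677444
`dedup.landed` bounce on the J3 uniqueness lemma, now reused from the fkl file instead of restated).

-an's reconciliation (22:24:32Z) with the typer's 21:51:56Z pre-screen: (iii) AN-34f — the TREE body `ANg17.EtaOneHasBottomRungDoorAtTwo`
(`F1Sign2/HeegnerCuspSymbolAtTwo.lean`, REF1 §143-audited v46 form) is FINAL, v50 reverts the v48 binder `W.HasSurjectiveModNGaloisRep 2` (no `…Surj`
twin); (iv) AN-34l `MinusUnitsOddRatioAtTwo` (v48) is KILLED AS TYPED by the typer pre-screen (`IsMinusSymbolUnit` is not maximal: with any symbol unit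
`u′₀` also `u′₀/2` is one, so «`u = k·u′`, `k` odd» fails) — recorded negative, never filed — and REPLACED by AN-34l′ `MinusPeriodUnitEqHalf` (the minus
period unit of a rational newform is exactly `1/2` in the tree's normalisation `im Λ_f = ℤ·Ω⁻_f/2`, `[r]⁻_f = Im{∞,r}_f/Ω⁻_f`), which is all the unit
transport the glue needs since AN-33c is PROVED for the unit `1/2` away from `N` (`ANg16.isMinusSymbolUnitAway_half`, `minusHalfSumProportionality`);
glue v50 `EtaOneReductionAtTwo := (HS) → AN-34e → AN-34g′ → AN-34l′ → AN-34m → AN-34f`.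
REF1 §145 = §143-add2 (refuter-bsd-f1-sign2-ref1 g13, `HOME/REF1-AUDIT-v1.md` §145; evidence `HOME/REF1-data/b145/` — `lean/Probe145.lean` 9c0e489cd8990842
(tree imports; AN-34k/l/l′/l″/m/n, `…Surj`, glue v48 + v50 verbatim; farm rc 0, 9 probe sorries; kernel J1–J6 std axioms), ENGINE 145 = kit j319290
(Sage: exact eclib minus symbols + 128-bit Eichler periods; `qfbsolve` pairs; 180 optimal curves 11 ≤ N ≤ 150, 1 384 (curve, ℓ) pairs); INBOX
2026-08-28T22:38:03Z) ONE LINE verbatim: «§143-add2 DONE = REF1 §145: file AN-34k / AN-34m / AN-34n / AN-34l′ + glue v50 from `g17/Sketch_v50.lean`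
7a84a000673b68b8; please ADD AN-34l″ `MinusPeriodUnitIsHalf` (existence form, the real prover target; AN-34l″ ⇒ AN-34l′ is the kernel one-liner
`minusPeriodUnitEqHalf_of_isHalf` in Probe145) — do NOT file AN-34l / glue v48 / the `…Surj` twin» — AN-34l KILLED AS TYPED is a kernel shape lemma
`an34l_shape_false` (refuted-misstated); AN-34l′ = the repair, THEOREM-GRADE S (words-proof forced by `periodLattice := closure (range cuspSymbol)` +
`im Λ_f = ℤΩ⁻/2`; note `isMinusSymbolUnitAway_half` covers γ0-cusps, NOT the γ∞-cusps −a/(Nb) — the proof goes through `subset_closure`); AN-34k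
SURVIVES theorem-grade mod AN-34a/c, binder «∃ odd a_q» LOAD-BEARING (65a1 fails axis independence at 8 primes; 0/305 inconsistent pairs inside the
binders); AN-34m SURVIVES THEOREM-GRADE (QR: admissible ℓ ≡ 7 (8) has (Δ/ℓ) = sign Δ, so `0 < W.Δ` is load-bearing — at Δ < 0 every admissible ℓ has
a_ℓ even, 510/510; Δ > 0: Chebotarev density (2/3)/[ℚ(ζ₈,√p*,√Δ):ℚ] > 0, no hidden coincidence; axis clause AUTOMATIC and CERTIFIED EXACTLY by PARI
`qfbsolve`: 76/76 admissible 3-cycle primes ℓ ≤ 400 on the 12 Δ > 0 odd-torsion optimal curves N ≤ 150 — the «230/490 uncertified» were box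
artefacts); AN-34n SURVIVES THEOREM-GRADE (cyclicity load-bearing; `IsImaginaryQuadratic` relaxable to E(K)[2] = 0) — and is now a TREE THEOREM
(bsd-line-fkl-p2 g14, p674563, discharged below by name); glue v50 GAP-FREE (inputs: Dt's coefficient dictionary + PROVED `minusHalfSumProportionality` /
`isMinusSymbolUnitAway_half`); (HS) second engine: F_ℓ/u ∈ ℤ 1 383/1 383, 0/305 failures inside the binders.
REF2 v41 §3 (refuter-bsd-f1-sign2-ref2 g41, `HOME/REF2-PLACEMENT-v41.md` 00028fe2f0cecc0c, INBOX 2026-08-28T22:25:05Z): AN-34k = KNOWN-ASSEMBLY of three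
printed facts ((α) Atkin–Lehner involutions change the orientation of Heegner points [cite: Gross1984, §4–§5] [cite: GrossZagier1986, I §3–4]; (β)
`φ∘w_q = ε_q·φ + φ(w_q ∞)` with `φ(cusp) − φ(∞)` torsion (Manin–Drinfeld); (γ) odd-order real torsion lies in E⁰(ℝ)) — not printed as one sentence,
theorem-grade S, beyond-print no; printed twin of the failure mode «egg torsion»: [cite: Zhai2016, §4] (Neumann–Setzer curves: the image of the cusp
[0] is the non-trivial 2-torsion point); AN-34n KNOWN/elementary (real locus E(ℝ) ≅ ℝ/ℤ × ℤ/2 for Δ > 0; tree `eggLemma`), theorem-grade S, SUPPORT row,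
beyond-print no; v48/v50 repairs (34e clause, 34g′, 34l′, 34m): no new literature bearing; slot reads p671131 / p671705 CLEAN.
PARTITION: none moved; beyond-print theorem: no; BSD not proved; 23715 not closed. -/

/-- **AN-34k `HeegnerCuspSymbolAxisIndependenceAtTwo` (THEOREM-CANDIDATE, BSD-free and Gross–Zagier-free; a COROLLARY of (HS) that is
provable on its own).**  Two axes `(a,b,d)`, `(a',b',d')` of level `N` that both carry a Heegner triple of the same prime discriminant `−ℓ` have the
same Heegner cusp symbol mod `2u`.  Mechanism (-an g17, ENGINE TT kit `j318559`): for `h(−ℓ)` odd there is exactly ONE self-paired Heegner point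
`x_𝔫` (`x̄ = w_N x`, i.e. `[𝔞]² = [𝔫]`) per orientation `𝔫`, each on an axis, and `w_q` (`q ‖ N`) permutes them EXACTLY: `x_{𝔫'} = w_q x_𝔫`, so
`φ(x_{𝔫'}) = ε_q φ(x_𝔫) + t_q` with `t_q = φ(w_q ∞) ∈ E₀(ℚ)_tors`; by AN-34c the cusp bit is the real component of `φ(x_𝔫) ∈ E₀(ℝ)`, and when
`E₀(ℚ)[2] = 0` (⟸ the binder: some `a_q` odd) every `t_q` has odd order, hence lies on the identity component, so the bit is orientation- and
axis-independent.  Census: irreducible 0 inconsistent `ℓ` / 4 911 (`j317959`); reducible: inconsistent `ℓ` occur on 5/179 curves WITH a rational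
torsion point on the egg and on 0/56 curves without (`j318288` × `j318559`).  Why it might fail: two different axes through the SAME orientation could
still differ if AN-34c's identification of the axis class were orientation-dependent in a way not mediated by `w_q` (none seen).
REF1 §145: SURVIVES theorem-grade mod AN-34a/c; the binder «∃ odd `a_q`» is LOAD-BEARING (65a1 fails axis independence at 8 primes ℓ = 79…251;
0/305 inconsistent pairs inside the binders).  REF2 v41 §3.1: KNOWN-ASSEMBLY ((α) [cite: Gross1984, §4–§5] orientations under Atkin–Lehner, (β)
Manin–Drinfeld, (γ) odd real torsion ⊂ E⁰(ℝ)); printed twin of the «egg torsion» failure mode [cite: Zhai2016, §4]; theorem-grade S; beyond-print no.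
[cite: GrossZagier1986, V.(2.2)] [cite: Watkins2005, §2] -/
def HeegnerCuspSymbolAxisIndependenceAtTwo : Prop :=
  ∀ (N : ℕ) [NeZero N] (f : CuspForm (Gamma0 N) 2), IsNewform0 f → coeffField f = ⊥ → IsFrickeEigen N f 1 →
    (∃ q : ℕ, q.Prime ∧ Odd q ∧ ¬ q ∣ N ∧ ∃ aq : ℤ, cuspCoeff f q = (aq : ℂ) ∧ Odd aq) →
    ∀ (u : ℚ), IsMinusPeriodUnit f u →
    ∀ (a b d m n a' b' d' m' n' : ℤ), a * d + (N : ℤ) * b ^ 2 = 1 → b ≠ 0 → a' * d' + (N : ℤ) * b' ^ 2 = 1 → b' ≠ 0 →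
    ∀ (ℓ : ℕ), ℓ.Prime → Odd ℓ → ¬ ℓ ∣ N → axisForm N a b d m n = -(ℓ : ℤ) → axisForm N a' b' d' m' n' = -(ℓ : ℤ) →
      ∃ z : ℤ, ratMinusSymbol f (axisCusp N a b) - ratMinusSymbol f (axisCusp N a' b') = 2 * z * u

/-- **AN-34l′ `MinusPeriodUnitEqHalf` (THEOREM-CANDIDATE, S-sized; replaces AN-34l `MinusUnitsOddRatioAtTwo`, which is REFUTABLE AS TYPED —
-ty g13 pre-screen 2026-08-28: `IsMinusSymbolUnit` is not maximal, so with any symbol unit `u′₀` also `u′₀/2` is one and `u = k·u′` with `k` odd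
fails; recorded as a negative edge, not re-filed).**  The minus PERIOD unit of a rational newform is EXACTLY `1/2` in the normalisation of
`ratMinusSymbol` (`[r]⁻_f = Im{∞,r}_f/Ω⁻_f`, `im Λ_f = ℤ·Ω⁻_f/2`): the cusps `−a/(Nb)` with `gcd(a, Nb) = 1` are exactly the `γ∞` for `γ ∈ Γ₀(N)` with
non-zero lower-left entry, `γ ↦ {∞, γ∞}_f` is a homomorphism of `Γ₀(N)` ONTO `Λ_f` (the `γ` with lower-left entry `0` map to `0`), so the values
`[γ∞]⁻_f` exhaust `im Λ_f/Ω⁻_f = ½ℤ`.  This is the unit transport the glue needs: (HS)/AN-34f are stated in period units `u`, AN-33c is PROVED for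
the unit `½` away from `N` (`isMinusSymbolUnitAway_half`, `minusHalfSumProportionality`).  Why it might fail: only through a mismatch between the
tree's `Ω⁻_f` convention and `Dt.L.lattice` (census in eclib units: `u_axis = u_all` on 2 283/2 283 curves).
REF1 §145: THEOREM-GRADE S (words-proof forced by `periodLattice := closure (range cuspSymbol)` + `im Λ_f = ℤΩ⁻/2`; NOTE `isMinusSymbolUnitAway_half`
covers the γ0-cusps, NOT the γ∞-cusps `−a/(Nb)` — the proof goes through `subset_closure`); the v48 AN-34l `MinusUnitsOddRatioAtTwo` is a kernel
shape-refutation `an34l_shape_false` (REF1 Probe145 J4) and is NOT filed.  **TREE THEOREM** (bsd-line-fkl-p2 g14, p676701): `_holds` below. [folklore] [cite: Cremona1997Algorithms, §2.8] -/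
def MinusPeriodUnitEqHalf : Prop :=
  ∀ (N : ℕ) [NeZero N] (f : CuspForm (Gamma0 N) 2), IsNewform0 f → coeffField f = ⊥ →
    ∀ (u : ℚ), IsMinusPeriodUnit f u → u = 1 / 2

/-- **AN-34l′ HOLDS (kernel; bsd-line-fkl-p2 g14, p676701 ACCEPTED, commit 4d501894eb68):** the tree theorem
`RankOneAtTwoOneDoor.minusPeriodUnitEqHalf` (file `Theorems/ByReductionTypeAtTwoRankOneAtTwoBigImageOddLocalOneDoorMinusPeriodUnitHalf.lean`; Manin's
homomorphism `Γ₀(N) → Λ_f`, `im Λ_f = ℤ·Ω⁻_f/2`, closure induction; UNCONDITIONAL, std axioms) has exactly this type — the glue's fourth input is discharged.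
(REF1 §145 J3 `isMinusPeriodUnit_unique` is the same file's `RankOneAtTwoOneDoor.isMinusPeriodUnit_unique`, reused here, not restated.) -/
theorem minusPeriodUnitEqHalf_holds : MinusPeriodUnitEqHalf :=
  Summit.BirchSwinnertonDyer.BirchSwinnertonDyer.Theorems.RankOneAtTwoOneDoor.minusPeriodUnitEqHalf

/-- **AN-34l″ `MinusPeriodUnitIsHalf` (REF1 §145's EXISTENCE FORM of AN-34l′ — the real prover target, ≈ 100 lines closure-induction over
`periodLattice := closure (range cuspSymbol)` and `im Λ_f = ℤ·Ω⁻_f/2`; typed VERBATIM from REF1 `Probe145.lean` 9c0e489cd8990842):** for a rational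
newform `f`, `1/2` IS a (hence the) minus period unit.  AN-34l″ ⇒ AN-34l′ is the kernel one-liner below.  **TREE THEOREM** (bsd-line-fkl-p2 g14,
p676701, `RankOneAtTwoOneDoor.minusPeriodUnitIsHalf`): `_holds` below. [folklore] [cite: Cremona1997Algorithms, §2.8] -/
def MinusPeriodUnitIsHalf : Prop :=
  ∀ (N : ℕ) [NeZero N] (f : CuspForm (Gamma0 N) 2), IsNewform0 f → coeffField f = ⊥ → IsMinusPeriodUnit f (1 / 2)

/-- **AN-34l″ HOLDS (kernel; bsd-line-fkl-p2 g14, p676701 ACCEPTED):** the tree theorem `RankOneAtTwoOneDoor.minusPeriodUnitIsHalf` has exactly this type. -/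
theorem minusPeriodUnitIsHalf_holds : MinusPeriodUnitIsHalf :=
  Summit.BirchSwinnertonDyer.BirchSwinnertonDyer.Theorems.RankOneAtTwoOneDoor.minusPeriodUnitIsHalf

/-- KERNEL glue (REF1 §145, Probe145 verbatim modulo the reused tree lemma `RankOneAtTwoOneDoor.isMinusPeriodUnit_unique`): AN-34l″ ⇒ AN-34l′ by
uniqueness of the period unit. -/
theorem minusPeriodUnitEqHalf_of_isHalf (h : MinusPeriodUnitIsHalf) : MinusPeriodUnitEqHalf :=
  fun N _ f hf hQ _ hu ↦ isMinusPeriodUnit_unique f hu (h N f hf hQ)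

/-- **AN-34m `AxisDoorThreeCyclePrimeSupplyAtTwo` (THEOREM-CANDIDATE, Literature-grade Chebotarev in a compositum; the strengthened supply C″
REF1 §143 asked for).**  For `Δ > 0` and `E(ℚ)[2] = 0` there are arbitrarily large primes `ℓ` that are SIMULTANEOUSLY door-admissible for `W`
(`DoorAdmissible W (−ℓ)`: Heegner hypothesis, for odd `N` also `ℓ ≡ 7 (8)`), `3`-CYCLE primes (`a_ℓ` odd) and AXIS-REPRESENTED (`−ℓ = axisForm N a b d m n`,
a condition in the ring class field of discriminant `16N` of `ℚ(√N)`).  The three Frobenius conditions live in linearly disjoint-enough fields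
(`ℚ(E[2])` is `S₃`, the genus/ring class field is abelian over `ℚ(√N)`, `ℚ(ζ₈)`), and they are COMPATIBLE (a `3`-cycle prime has `(Δ/ℓ) = +1`, which is what
admissibility forces at `Δ > 0`).  Why it might fail: a hidden coincidence `ℚ(√Δ) ⊂` genus field of the axis form could make the conditions
contradictory for some `N` (census: every `η = 1` slice curve tested has such primes, 260/490 certified in a small box, `j317959`).
REF1 §145: SURVIVES THEOREM-GRADE — QR: an admissible `ℓ ≡ 7 (8)` has `(Δ/ℓ) = sign Δ`, so `0 < W.Δ` is LOAD-BEARING (at `Δ < 0` every admissible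
`ℓ` has `a_ℓ` even, 510/510); `Δ > 0`: Chebotarev density `(2/3)/[ℚ(ζ₈,√p*,√Δ):ℚ] > 0`, no hidden coincidence; the AXIS clause is AUTOMATIC (odd
`h(−ℓ)` ⇒ a c∘w_N-fixed Heegner point per orientation, on a rational axis) and CERTIFIED EXACTLY by PARI `qfbsolve`: 76/76 admissible 3-cycle
primes `ℓ ≤ 400` on the 12 `Δ > 0` odd-torsion optimal curves `N ≤ 150` (the «230/490 uncertified» of ENGINE HC were box artefacts; R-145-c to -data:
certify by `qfbsolve`, not boxes).  REF2 v41 §3.3: no new literature bearing. [cite: Cox2013PrimesOfTheForm, Thm. 9.12] [cite: LagariasOdlyzko1977, Thm. 1.1] -/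
def AxisDoorThreeCyclePrimeSupplyAtTwo : Prop :=
  ∀ (W : WeierstrassCurve ℚ) [W.IsElliptic] [W.IsGloballyMinimal] [NeZero (W.conductorNorm ℤ)],
    0 < W.Δ → NoRationalTwoTorsion W →
    ∀ (M : ℕ), ∃ (ℓ : ℕ), M < ℓ ∧ ℓ.Prime ∧ DoorAdmissible W (-(ℓ : ℤ)) ∧ Odd (W.frobeniusTrace ℓ) ∧
      ∃ (a b d m n : ℤ), a * d + (W.conductorNorm ℤ : ℤ) * b ^ 2 = 1 ∧ b ≠ 0 ∧ axisForm (W.conductorNorm ℤ) a b d m n = -(ℓ : ℤ)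

/-- The REDUCTION of record (shape only; v50 glue): `η = 1` at a `3`-cycle prime `q` (in PERIOD units `u`) ⟹ by AN-34l′ `u = ½` ⟹ by the PROVED
away-from-`N` AN-33c (`minusHalfSumProportionality` with `isMinusSymbolUnitAway_half`) `2F_ℓ ≡ a_ℓ·(2F_q)/a_q ≡ 1 (mod 2)` at every `3`-cycle prime `ℓ ∤ N` ⟹ by AN-34m pick such an `ℓ`
that is also door-admissible and axis-represented ⟹ by (HS) the axis cusp symbol is odd ⟹ by AN-34g′ the lattice bit is set ⟹ by AN-34e (with its
`3`-cycle clause) `HasBottomRungDoorAtTwo W`. [folklore] -/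
def EtaOneReductionAtTwo : Prop :=
  HeegnerCuspHalfSumLawAtTwo → OddHeegnerCuspSymbolCertifiesBottomRungDoorAtTwo → AxisMinusPeriodUnitLatticeBookkeepingAtTwo →
    MinusPeriodUnitEqHalf → AxisDoorThreeCyclePrimeSupplyAtTwo → EtaOneHasBottomRungDoorAtTwo

/-! ### §20.7 AN-34n — the κ·m DICTIONARY (THEOREM-CANDIDATE, pure Mordell–Weil + real topology; -an v49/v50; prover ask to bsd-line-fkl-p2) -/

/-- **AN-34n `RationalPointEggKappaIndexDictionaryAtTwo` (THEOREM-CANDIDATE, prover-sized; the converse-completion of the tree's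
egg lemma `eggLemma` for RATIONAL points).**  `Δ > 0`, `E(ℚ)[2] = 0`, `E(ℚ)/tors` cyclic (rank `≤ 1`), `K` imaginary quadratic, `P ∈ E(K)`
a point with RATIONAL coordinates.  Then `P` is on the egg up to torsion iff BOTH `E(ℚ)` meets the egg (`κ_E = 1`: the generator lies on
the egg) AND `P ∉ 2E(K) + E(K)_tors` (`2`-divisibility exponent `0`).  Proof sketch: `P = k·g + t` with `t` of odd order (`⊂ E⁰(ℝ)`), so
`P` on the egg iff `k` odd and `g ∉ E⁰(ℝ)`; and `k` odd iff `P ∉ 2E(K) + tors` (descend `2Q ∈ E(ℚ) + tors` to `ℚ` using `E(K)[2] = 0`,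
which follows from `E(ℚ)[2] = 0` since the `2`-division cubic stays irreducible over a quadratic field).  WHY IT MATTERS: for a `W_N = +1`
datum with `L(E,1) = 0` the Heegner trace `y_K` is EXACTLY `ℚ`-rational (Gross's `x̄_𝔞 = w_N x_{𝔞⁻¹𝔫⁻¹}` and `φ ∘ w_N = φ + φ(0) = φ`), so with
AN-34c the HEEGNER CUSP BIT of a prime door `−ℓ` equals `κ_E · [m_ℓ = 0]` — it detects an odd Heegner index EXACTLY on the curves whose
generator lies on the egg, and is blind (`≡ 0`) on the others; (HS) then reads `κ_E·[m_ℓ odd] ≡ η_f·[a_ℓ odd]` at every prime door (the cell's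
law D and «κ = η» in one `f`-intrinsic cycle statement).
REF1 §145: SURVIVES THEOREM-GRADE (cyclicity load-bearing; `IsImaginaryQuadratic` relaxable to `E(K)[2] = 0`).  REF2 v41 §3.2: KNOWN/elementary
(real locus `E(ℝ) ≅ ℝ/ℤ × ℤ/2` for `Δ > 0`; tree `eggLemma`), SUPPORT row, beyond-print no.  **TREE THEOREM** (bsd-line-fkl-p2 g14, p674563): `_holds` below. [folklore] -/
def RationalPointEggKappaIndexDictionaryAtTwo : Prop :=
  ∀ (W : WeierstrassCurve ℚ) [W.IsElliptic], 0 < W.Δ → NoRationalTwoTorsion W →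
    (∃ g : W.toAffine.Point, ∀ P : W.toAffine.Point, ∃ k : ℤ, P - k • g ∈ AddCommGroup.torsion W.toAffine.Point) →
    ∀ (K : Type) [Field K] [NumberField K], IsImaginaryQuadratic K →
    ∀ (x y : ℚ) (h : (W.baseChange K).toAffine.Nonsingular (algebraMap ℚ K x) (algebraMap ℚ K y)),
      (EggUpToTorsion W K (WeierstrassCurve.Affine.Point.some _ _ h) ↔
        (MeetsEgg W ∧ HasTwoDivisibilityUpToTorsion W K (WeierstrassCurve.Affine.Point.some _ _ h) 0))

/-- **AN-34n HOLDS (kernel, bsd-line-fkl-p2 g14, p674563 ACCEPTED, commit 77462cc34692):** the tree theorem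
`RankOneAtTwoOneDoor.rationalPointEggKappaIndexDictionaryAtTwo` (file `Theorems/ByReductionTypeAtTwoRankOneAtTwoBigImageOddLocalOneDoorEggKappaDictionary.lean`,
`eggUpToTorsion_iff_meetsEgg_and_exponent_zero`; UNCONDITIONAL, std axioms) has exactly this type. -/
theorem rationalPointEggKappaIndexDictionaryAtTwo_holds : RationalPointEggKappaIndexDictionaryAtTwo :=
  Summit.BirchSwinnertonDyer.BirchSwinnertonDyer.Theorems.RankOneAtTwoOneDoor.rationalPointEggKappaIndexDictionaryAtTwo

end Summit.BirchSwinnertonDyer.Rank1Residual.F1Sign2.ANg17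

end
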